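import Summits.QuantumFields.QCD.Theorems.NestedDissectionSeaRobustYangMillsStubDeployment
import Summits.QuantumFields.QCD.Theorems.NestedDissectionSeaRobustYangMillsStubEngineOfAnnealed

/-!
# Line `local-ac-open-certificate` for the crux `RobustYangMills` (stmt-QuantumFields-13897) —
# the strengthened certificate of reshape r3 and the CLOSED stub `stub_deploymentUKP`

Crux: `Summit.QuantumFields.QCD.Theses.NestedDissectionSea.RobustYangMills`; checked skeleton
`Cruxes/RobustYangMills/Lines/local-ac-open-certificate.lean` (reshape r3). Companion modules:
`NestedDissectionSeaRobustYangMillsLocalAC` (§0–§1: `spec`, `wilsonSpec`, `LocalACToolkit`,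
`stub_localAC`), `NestedDissectionSeaRobustYangMillsStubDeployment` (§2–§3 of reshape r2:
`WilsonGoodCertificate`, `IRConeClustering`, `Deployment`, `level_numerics`, `final_numeric`,
`level_bound`, `stub_deployment`) and `NestedDissectionSeaRobustYangMillsStubEngineOfAnnealed`
(§2′ of reshape r3: `PerturbedMixingEngineUKP`, `AnnealedEngine`, `stub_engineOfAnnealed`).

This module carries, verbatim from the skeleton, the two remaining Props of reshape r3:

* `WilsonGoodCertificateUKP` — the landed `WilsonGoodCertificate` (statement of the OPEN, YM-hard
  stub `stub_wilsonCertificate`) strengthened by the conjunct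
  `UniformKernelPeierls (cellOf q) (wilsonSpec ρ₃ (β' k)) good p`: Peierls rarity of bad cells for
  Wilson's KERNELS, uniformly in the volume and in the boundary condition away from boundary
  defects (the datum the engine `PerturbedMixingEngineUKP` consumes);
* `DeploymentUKP` — toolkit + UKP-engine + UKP-certificate give uniform IR clustering of the
  translation-invariant sup-small range-controlled cone for every `κ > 0`;

and proves **`stub_deploymentUKP : DeploymentUKP`** (CLOSED): the landed proof of
`stub_deployment` (frames `prodFrame (2S+1) ⌈2ℓ₀/a_k⌉ μ`, `level_numerics`, the Literature
corollaries `isLocallyAC_kernel_of_card_le` / `hasLeak_kernel_of_card_le` / `hasLeak_kernel_zero`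
of the toolkit, `level_bound`, `connectedCorr_eq_covCorr`), with the certificate's third conjunct
threaded to the engine's extra binder (`wilsonSpec ρ β` is the engine's reference specification
`γ₀` on the nose). Constants as landed: `c₁ = c₁(p₀(n))`,
`η₁ = min(ε₁/(2·10⁴), log(1+Λ₀)/(4·10⁴(4n+1)⁴))`, `Δ = κₑ/(6ℓ₀)`.

Sources: Georgii (2011) Rem. 1.24, Ch. 8; Osterwalder–Seiler, Ann. Phys. 110 (1978) §2; Seiler, LNP
159 (1982) Ch. 2; Dobrushin–Shlosman (1985) §2.
-/

set_option autoImplicit false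

noncomputable section

namespace Summit.QuantumFields.QCD.Cruxes.RobustYangMills.LocalAcOpenCertificate

open scoped BigOperators Topology ENNReal
open Filter MeasureTheory
open Literature.MathematicalPhysics.QuantumLattice Literature.MathematicalPhysics.AQFT
  Literature.MathematicalPhysics.QuantumFieldTheory
open Literature.Probability.LatticeModels (CoarseIdx cdist shellCount cellCount IsGoodFS HasLeak IsLocallyAC
  PeierlsRare UniformKernelPeierls IsTorusFrame isTorusFrame_axisFrame Specification IsSpecification
  IsGibbsMeasure)

/-! ## §2′ (continued) The strengthened Wilson certificate and the deployment of reshape r3 -/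

/-- **The strengthened SU(3) Wilson certificate** (reshape r3; statement of the OPEN stub
`stub_wilsonCertificate`, W-free, YM-hard): a window `n ≥ 1` such that for every rarity `p > 0`
there are `ε₀` (`2ε₀·shellCount ≤ 1`) and a physical scale `c₁ > 0` with: for all scaling / a.f.
data and cell scales `C ≥ c₁`, eventually in `k`, on every odd torus and every family of torus
frames of scale `⌈C/(Λ'a_k)⌉` with `≥ 4n+3` cells per axis, cell-local measurable GOOD sets for
which Wilson's kernels satisfy the good-exterior condition `(n, ε₀)`, bad cells are Peierls-rare
with ratio `p` under Wilson's measure, AND Wilson's kernels satisfy the uniform Peierls bound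
`UniformKernelPeierls (cellOf q) (wilsonSpec ρ₃ (β' k)) good p`. -/
def WilsonGoodCertificateUKP : Prop :=
  ∃ n : ℕ, 1 ≤ n ∧ ∀ p : ℝ, 0 < p → ∃ ε₀ c₁ : ℝ, 0 ≤ ε₀ ∧ 2 * ε₀ * (shellCount 4 n : ℝ) ≤ 1 ∧ 0 < c₁ ∧
    ∀ (a : ℕ → ℝ), (∀ k, 0 < a k) → Tendsto a atTop (𝓝 0) →
    ∀ (β' : ℕ → ℝ) (Λ' : ℝ), 0 < Λ' → Tendsto (fun k => β' k - afBeta 0 Λ' (a k)) atTop (𝓝 0) →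
    ∀ C : ℝ, c₁ ≤ C →
    ∀ᶠ k in atTop, ∀ (S : ℕ) (μc : Fin 4 → ℕ) (q : (i : Fin 4) → ZMod (2 * S + 1) → ZMod (μc i + 1)),
      (∀ i, 4 * n + 3 ≤ μc i + 1) → (∀ i, IsTorusFrame (2 * S + 1) ⌈C / (Λ' * a k)⌉₊ (q i)) →
      ∃ good : CoarseIdx μc → Set (GaugeConfig 4 (2 * S + 1) SU3),
        IsGoodFS (cellOf q) (wilsonSpec (Lt := 2 * S + 1) ρ₃ (β' k)) good n ε₀ ∧
        PeierlsRare good (wilsonMeasure (d := 4) (L := 2 * S + 1) ρ₃ (β' k)) p ∧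
        UniformKernelPeierls (cellOf q) (wilsonSpec (Lt := 2 * S + 1) ρ₃ (β' k)) good p

/-- **Deployment with the kernel-uniform Peierls datum** (reshape r3; statement of
`stub_deploymentUKP`): toolkit + UKP-engine + UKP-certificate give uniform IR clustering of the
translation-invariant cone for EVERY decay rate `κ > 0`, with a budget `η₁(κ) > 0` and the
certificate's scale `c₁`. -/
def DeploymentUKP : Prop :=
  LocalACToolkit → PerturbedMixingEngineUKP → WilsonGoodCertificateUKP →
    ∃ c₁ : ℝ, 0 < c₁ ∧ ∀ κ : ℝ, 0 < κ → ∃ η₁ : ℝ, 0 < η₁ ∧ IRConeClustering η₁ κ c₁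

/-! ## Proof of `stub_deploymentUKP` -/

section Proof

/-- **`stub_deploymentUKP` (CLOSED)**: toolkit + UKP-engine + UKP-certificate give uniform IR
clustering of the translation-invariant sup-small range-controlled cone, for every `κ > 0` — the
landed proof of `stub_deployment` with the certificate's kernel-uniform Peierls conjunct handed to
the engine. Constants: `c₁ = c₁(p₀(n))` of the certificate;
`η₁ = min(ε₁/(2·10⁴), log(1+Λ₀)/(4·10⁴(4n+1)⁴))`; `Δ = κₑ/(6ℓ₀)`; frames of scale `⌈2ℓ₀/a_k⌉`. -/
theorem stub_deploymentUKP : DeploymentUKP := by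
  rintro ⟨-, -, hDLR⟩ hE ⟨n, hn, hcert⟩
  obtain ⟨p₀, ε₁, hp₀, hε₁, heng⟩ := hE n hn
  obtain ⟨ε₀, c₁, hε₀, hshell, hc₁, hcert⟩ := hcert p₀ hp₀
  refine ⟨c₁, hc₁, fun κ hκ => ?_⟩
  obtain ⟨Λ₀, κₑ, C₀, hΛ₀, hκₑ, hC₀, hEng⟩ := heng ε₀ κ hε₀ hshell hκ
  obtain ⟨X, hX⟩ : ∃ X : ℝ, X = 4 * (10 ^ 4 * (4 * (n : ℝ) + 1) ^ 4) := ⟨_, rfl⟩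
  have hXpos : 0 < X := by rw [hX]; positivity
  obtain ⟨η₁, hη₁⟩ : ∃ η₁ : ℝ, η₁ = min (ε₁ / (2 * 10 ^ 4)) (Real.log (1 + Λ₀) / X) := ⟨_, rfl⟩
  have hη₁pos : 0 < η₁ := by
    rw [hη₁]; exact lt_min (by positivity) (div_pos (Real.log_pos (by linarith)) hXpos)
  have hηε : 2 * η₁ * 10 ^ 4 ≤ ε₁ := by
    have h' : η₁ ≤ ε₁ / (2 * 10 ^ 4) := hη₁ ▸ min_le_left _ _
    rw [le_div_iff₀ (by positivity)] at h'; linarith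
  have hηΛ : Real.exp (4 * η₁ * (10 ^ 4 * (4 * n + 1) ^ 4)) - 1 ≤ Λ₀ := by
    have h1 : η₁ ≤ Real.log (1 + Λ₀) / X := hη₁ ▸ min_le_right _ _
    rw [le_div_iff₀ hXpos] at h1
    have h2 : 4 * η₁ * (10 ^ 4 * (4 * (n : ℝ) + 1) ^ 4) = η₁ * X := by rw [hX]; ring
    rw [h2, sub_le_iff_le_add]
    calc Real.exp (η₁ * X) ≤ Real.exp (Real.log (1 + Λ₀)) := Real.exp_le_exp.2 h1
      _ = 1 + Λ₀ := Real.exp_log (by linarith)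
      _ = Λ₀ + 1 := add_comm _ _
  have hΛl : (0 : ℝ) ≤ Real.exp (4 * η₁ * (10 ^ 4 * (4 * n + 1) ^ 4)) - 1 :=
    sub_nonneg.2 (Real.one_le_exp (by positivity))
  refine ⟨η₁, hη₁pos, ?_⟩
  intro a L ha ha₀ haL β' Λ' hΛ' hβ ℓ₀ hℓ₀
  have hℓ₀pos : 0 < ℓ₀ := pos_of_mul_pos_right (hc₁.trans_le hℓ₀) hΛ'.le
  refine ⟨κₑ / (6 * ℓ₀), by positivity, fun A B => ?_⟩
  obtain ⟨Ca, hCa⟩ := A.bounded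
  obtain ⟨Cb, hCb⟩ := B.bounded
  refine ⟨C₀ * Ca * Cb * A.supp.card * B.supp.card *
    Real.exp (κₑ * (((A.supp.sup fun e => (e.1 0).natAbs) +
      (B.supp.sup fun e => (e.1 0).natAbs) + 2 : ℕ) : ℝ)), ?_⟩
  have hev1 : ∀ᶠ k in atTop, a k ≤ min 1 ℓ₀ := ha₀.eventually_le_const (lt_min one_pos hℓ₀pos)
  have hev2 : ∀ᶠ k in atTop, (4 * (n : ℝ) + 3) * (2 * ℓ₀ + 1) ≤ a k * L k :=
    haL.eventually_ge_atTop _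
  have hev3 := hcert a ha ha₀ β' Λ' hΛ' hβ (2 * (Λ' * ℓ₀)) (by linarith)
  filter_upwards [hev1, hev2, hev3] with k hk1 hk2 hk3
  intro S hS w hw hrc hinv t ht
  obtain ⟨hb, hb', hbb, h2b, h1, h2, hμ, h6⟩ := level_numerics (n := n) (ha k)
    (hk1.trans (min_le_left _ _)) (hk1.trans (min_le_right _ _)) hk2 hS
  set b' := ⌈2 * ℓ₀ / a k⌉₊ with hb'def
  set μ := (2 * S + 1) / b' - 1 with hμdef
  have hCeq : ⌈2 * (Λ' * ℓ₀) / (Λ' * a k)⌉₊ = b' := by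
    rw [hb'def]; congr 1; field_simp
  obtain ⟨good, hFS, hPR, hUKP⟩ := hk3 S (fun _ => μ) (prodFrame (2 * S + 1) b' μ) (fun _ => hμ)
    (fun _ => by rw [hCeq]; exact isTorusFrame_axisFrame hb' h1 h2)
  -- DLR inputs (toolkit (c)), local a.c. and leak profiles (toolkit (a), (b) through cells)
  have hρ : Continuous ρ₃ := continuous_fundamentalRep _
  obtain ⟨hspw, hgw⟩ := hDLR SU3 3 ρ₃ hρ (2 * S + 1) _ (β' k) w
  obtain ⟨hsp0, hg0⟩ := hDLR SU3 3 ρ₃ hρ (2 * S + 1) 1 (β' k) 0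
  rw [QuasiLocalGaugePerturbation.perturbedMeasure_zero] at hg0
  have hK : ∀ A : Finset (Edge 4 (2 * S + 1)),
      ((A.image fun e => blockCorner ⌊ℓ₀ / a k⌋₊ e.1).card : ℝ) ≤
        10 ^ 4 * cellCount (cellOf (prodFrame (2 * S + 1) b' μ)) A := fun A => by
    exact_mod_cast card_image_blockCorner_le_mul_cellCount (μ := μ) hb hb' hbb h2 A
  have hcon := cdist_cellOf_le_of_blockCorner_near (d := 4) (μ := μ) hb hb' h2b h1
  have hAC' : IsLocallyAC (cellOf (prodFrame (2 * S + 1) b' μ)) (spec ρ₃ (β' k) w)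
      (wilsonSpec ρ₃ (β' k)) ε₁ :=
    QuasiLocalGaugePerturbation.isLocallyAC_kernel_of_card_le ρ₃ hρ _ hK (β' k) hκ.le hη₁pos.le hηε
      w hw
  have hLw : HasLeak (cellOf (prodFrame (2 * S + 1) b' μ)) (spec ρ₃ (β' k) w) n
      (Real.exp (4 * η₁ * (10 ^ 4 * (4 * n + 1) ^ 4)) - 1) κ :=
    QuasiLocalGaugePerturbation.hasLeak_kernel_of_card_le ρ₃ hρ hb _ (by norm_num) hK hcon (β' k) hκ.le
      n w hw hrc
  have hL0 : HasLeak (cellOf (prodFrame (2 * S + 1) b' μ)) (wilsonSpec ρ₃ (β' k)) n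
      (Real.exp (4 * η₁ * (10 ^ 4 * (4 * n + 1) ^ 4)) - 1) κ :=
    QuasiLocalGaugePerturbation.hasLeak_kernel_zero ρ₃ hρ hb _ (by norm_num) hK hcon (β' k) hκ.le n hΛl
  -- the UKP-engine at this level (reference kernels = Wilson's, with the certificate's uniform
  -- Peierls bound), for the covariance; (h1) turns `connectedCorr` into the covariance
  rw [w.connectedCorr_eq_covCorr ρ₃ (β' k) hinv, w.covCorr_eq_integral]
  exact level_bound hb' h2 hκₑ hC₀ hℓ₀pos h6 _
    (hEng (fun _ => μ) (Edge 4 (2 * S + 1)) SU3 (cellOf (prodFrame (2 * S + 1) b' μ))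
      (wilsonSpec ρ₃ (β' k)) (spec ρ₃ (β' k) w) good (wilsonMeasure ρ₃ (β' k))
      (w.perturbedMeasure ρ₃ (β' k)) p₀ _ (fun _ => hμ) hsp0 hspw hg0 hgw hFS hΛl hηΛ hL0 hLw hAC'
      hp₀.le le_rfl hPR hUKP)
    A B hCa hCb ht

end Proof

end Summit.QuantumFields.QCD.Cruxes.RobustYangMills.LocalAcOpenCertificate

end
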